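import Summits.BirchSwinnertonDyer.Rank1Residual.P2.CornerFTwoModelAtlas
import HarnessLib

/-!
# Leaf CornerF @ `p = 2` — THE MODEL ATLAS, file 2/2 (cell `bsd-print-cf2`, D-0131 (2) print tier,
# typer ty2): the three class cruxes of route `PrintCf2` IN MODEL CURRENCY

HONEST FRAMING (cell `bsd-print-cf2`, HOME `run/shared/lean/pub/bsd-print-cf2/`, verbatim in every
file): the partition leaf is `CornerF W 2` — `W/ℚ` globally minimal elliptic WITH CM and
`ord_{s=1} L(E,s) = 1`, at the prime `2` (rung leaf `WAllCornerFTwo`; OPEN AS A CLASS). File 1/2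
(`CornerFTwoModelAtlas.lean`) reduces the three `2`-adic CM types to explicit model families
(Silverman X.5.4). Here: the converse memberships (every model of every family is in its type and has
CM) and THE DISCHARGE INTERFACE OF THE THREE CRUXES — each class statement of route `PrintCf2`
(p4's slice names `WAllCornerFTwoRamified`, `WAllCornerFTwoInertGood ∧ WAllCornerFTwoInertBad`,
`WAllCornerFTwoSplitBad`, the consequents of items stmt-BirchSwinnertonDyer-20362 / 20363 / 20368)
is EQUIVALENT to a finite conjunction of statements about explicit families, which is the currency
every printed theorem is typed in. Fact-free: NO arithmetic fact, NO definition, NO named fact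
(D-0026); the only transport is ty2 g0's `CongruentNumber.bsdp_iff` / `analyticRank_eq` (Miller's
`BSD(E,p)` between two globally minimal models) on the `E_n` branch — every other branch keeps the
minimal model `W` itself, so no minimality claim about twist models is needed.

## Contents

* §2′ converses: `hasCM_and_cmRamified_two_of_smul_quartic` (`y² = x³ + Ax`), `…_of_j`
  (`j ∈ {287496, 8000}`), `hasCM_and_cmInert_two_of_smul_sextic` (`y² = x³ + B`), `…_of_j` (the seven
  inert `j ≠ 0`), `hasCM_and_cmSplit_two_of_j` (`j ∈ {−3375, 16581375}`).
* §3 `wAllCornerFTwoRamified_iff_models` — the ramified class ⟺ (BSD(E_n,2) ON THE NAMED MODEL for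
  every square-free `n` with `r_an(E_n) = 1`) ∧ (the quartic twists with `−A ∉ ℤ²`) ∧ (`j = 287496`
  twists) ∧ (`j = 8000` twists); `inertUnion_iff_inertSlices` (the crux's consequent ⟺ p4's two
  inert slices); `wAllCornerFTwoInert_iff_models` (eight families); `wAllCornerFTwoSplitBad_iff_models`
  (two twist families with `¬ Good W 2`).

What this buys the cell: (i) the residual of each crux is a list of EXPLICIT families, each either
carrying print (`E_n`: TYZ / Tian / LLT / Monsky; `36a1`-twists `y² = x³ + c³` ⊂ the `j = 0` family:
Shu–Zhai) or print-free as of the cell's dossier (quartic twists with `−A ∉ ℤ²`; `j ∈ {287496, 8000}`;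
`j = 54000`; `27a4`-twists; the five odd fields), so a layer-2 `j`-cut (planner BC3) is a conjunction
of named statements; (ii) the binders of the two INERT bundle theorems are read off the model:
Kriz–Li 2019 Thm. 1.12 wants `E(ℚ)[2] = 0` — the non-cube sextics and `j ∈ {−12288000, −32768,
−884736, −884736000, −147197952000, −262537412640768000}` (tree: `X12.no_twoTorsion_of_j_eq_*`,
`ratTwoTorsionCard_eq_one_of_j_eq_neg12288000`) —, Shu–Zhai 2021 wants `E[2](ℚ) ≅ ℤ/2` —
`j = 54000` (`X12.exists_twoTorsion_of_j_eq_54000`) and the cube sextics `y² = x³ + c³ = 36a1^{(c)}`;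
nothing here restates those tables.

References: [SilvermanAEC2009] X.5 Prop. 5.4, Cor. 5.4.1; [SilvermanATAEC1994] App. A §3; [Cox2013]
§5.B Prop. 5.16 / Cor. 5.17; [Miller2011LMS] Def. 1.1 (BSD(E,p)); HOME/PLAN.md §0–§3;
`WAll/TargetCMTwoSlices.lean`; `P2/CornerFTwoPrintInterface.lean`; `P2/CornerFTwoModelAtlas.lean`.
-/

noncomputable section

open scoped Classical

open WeierstrassCurve Literature.NumberTheory.EllipticCurves
  Literature.NumberTheory.EllipticCurves.Rank1Residual

set_option autoImplicit false

namespace Summit.BirchSwinnertonDyer.Rank1Residual.P2.CornerFTwo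

open Atlas

/-! ## §2′ Conversely: every model of every family is in its type (and has CM) -/

section Converses

variable {W : WeierstrassCurve ℚ} [W.IsElliptic]

/-- A model of `y² = x³ + Ax` (`A ≠ 0`) has CM (`j = 1728`, `ℤ[i]`) and `2` RAMIFIED in `K`.
[cite: Cox2013, §5.B Prop. 5.16 and Cor. 5.17] -/
theorem hasCM_and_cmRamified_two_of_smul_quartic {A : ℚ} (hA : A ≠ 0) {C : VariableChange ℚ}
    (hC : C • (⟨0, 0, 0, A, 0⟩ : WeierstrassCurve ℚ) = W) : W.HasCM ∧ CMRamified W 2 := by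
  have hj := j_eq_1728_of_smul_quartic hA hC
  refine ⟨WeierstrassCurve.hasCM_of_j_eq_1728 W hj, ?_⟩
  rw [CMRamified, hj]; norm_num [cmFieldDiscrOfJ]

/-- A model of `y² = x³ + B` (`B ≠ 0`) has CM (`j = 0`, `ℤ[ζ₃]`) and `2` INERT in `K = ℚ(√−3)`.
[cite: Cox2013, §5.B Prop. 5.16 and Cor. 5.17] -/
theorem hasCM_and_cmInert_two_of_smul_sextic {B : ℚ} (hB : B ≠ 0) {C : VariableChange ℚ}
    (hC : C • (⟨0, 0, 0, 0, B⟩ : WeierstrassCurve ℚ) = W) : W.HasCM ∧ CMInert W 2 := by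
  have hj := j_eq_zero_of_smul_sextic hB hC
  have hcm : W.HasCM := WeierstrassCurve.hasCM_of_j_eq_zero W hj
  exact ⟨hcm, (cmInert_two_iff_of_hasCM hcm).2 (Or.inl (by rw [hj]; norm_num [cmFieldDiscrOfJ]))⟩

/-- A model of a twist of a curve `E` with `j(E) ∈ {287496, 8000}` has CM and `2` RAMIFIED in `K`;
stated through `j`: `j(W) = 287496 ∨ j(W) = 8000 ⇒ HasCM ∧ CMRamified W 2`.
[cite: Cox2013, §5.B Prop. 5.16 and Cor. 5.17] -/
theorem hasCM_and_cmRamified_two_of_j (hj : W.j = 287496 ∨ W.j = 8000) :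
    W.HasCM ∧ CMRamified W 2 := by
  rcases hj with hj | hj
  · refine ⟨WeierstrassCurve.hasCM_of_j_eq_287496 W hj, ?_⟩
    rw [CMRamified, hj]; norm_num [cmFieldDiscrOfJ]
  · refine ⟨WeierstrassCurve.hasCM_of_j_eq_8000 W hj, ?_⟩
    rw [CMRamified, hj]; norm_num [cmFieldDiscrOfJ]

/-- `j(W) ∈ {54000, −12288000, −32768, −884736, −884736000, −147197952000, −262537412640768000}`
`⇒ HasCM ∧ CMInert W 2` (the seven inert `j ≠ 0`). [cite: Cox2013, §5.B Prop. 5.16 and Cor. 5.17] -/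
theorem hasCM_and_cmInert_two_of_j
    (hj : W.j = 54000 ∨ W.j = -12288000 ∨ W.j = -32768 ∨ W.j = -884736 ∨ W.j = -884736000 ∨
      W.j = -147197952000 ∨ W.j = -262537412640768000) :
    W.HasCM ∧ CMInert W 2 := by
  have key : ∀ (hcm : W.HasCM), (cmFieldDiscrOfJ W.j = -3 ∨ cmFieldDiscrOfJ W.j = -11 ∨
      cmFieldDiscrOfJ W.j = -19 ∨ cmFieldDiscrOfJ W.j = -43 ∨ cmFieldDiscrOfJ W.j = -67 ∨
      cmFieldDiscrOfJ W.j = -163) → W.HasCM ∧ CMInert W 2 :=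
    fun hcm hd => ⟨hcm, (cmInert_two_iff_of_hasCM hcm).2 hd⟩
  rcases hj with hj | hj | hj | hj | hj | hj | hj
  · exact key (WeierstrassCurve.hasCM_of_j_eq_54000 W hj) (by rw [hj]; norm_num [cmFieldDiscrOfJ])
  · exact key (WeierstrassCurve.hasCM_of_j_eq_neg12288000 W hj)
      (by rw [hj]; norm_num [cmFieldDiscrOfJ])
  · exact key (WeierstrassCurve.hasCM_of_j_eq_neg32768 W hj) (by rw [hj]; norm_num [cmFieldDiscrOfJ])
  · exact key (WeierstrassCurve.hasCM_of_j_eq_neg884736 W hj)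
      (by rw [hj]; norm_num [cmFieldDiscrOfJ])
  · exact key (WeierstrassCurve.hasCM_of_j_eq_neg884736000 W hj)
      (by rw [hj]; norm_num [cmFieldDiscrOfJ])
  · exact key (WeierstrassCurve.hasCM_of_j_eq_neg147197952000 W hj)
      (by rw [hj]; norm_num [cmFieldDiscrOfJ])
  · exact key (WeierstrassCurve.hasCM_of_j_eq_neg262537412640768000 W hj)
      (by rw [hj]; norm_num [cmFieldDiscrOfJ])

/-- `j(W) ∈ {−3375, 16581375} ⇒ HasCM ∧ CMSplit W 2` (`K = ℚ(√−7)`).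
[cite: Cox2013, §5.B Prop. 5.16 and Cor. 5.17] -/
theorem hasCM_and_cmSplit_two_of_j (hj : W.j = -3375 ∨ W.j = 16581375) :
    W.HasCM ∧ CMSplit W 2 := by
  rcases hj with hj | hj
  · exact ⟨WeierstrassCurve.hasCM_of_j_eq_neg3375 W hj,
      BurungaleCastellaSkinnerTian2022.cmSplit_two_of_cmFieldDiscrOfJ_eq W
        (by rw [hj]; norm_num [cmFieldDiscrOfJ])⟩
  · exact ⟨WeierstrassCurve.hasCM_of_j_eq_16581375 W hj,
      BurungaleCastellaSkinnerTian2022.cmSplit_two_of_cmFieldDiscrOfJ_eq W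
        (by rw [hj]; norm_num [cmFieldDiscrOfJ])⟩

end Converses

/-! ## §3 The three classes of route PrintCf2 in model currency -/

/-- **THE RAMIFIED CLASS IN MODEL CURRENCY** (consequent of crux `RamifiedTwoRankOneOfFacts`, item
stmt-BirchSwinnertonDyer-20362; p4's slice `WAllCornerFTwoRamified`). It is EQUIVALENT to the
conjunction of four explicit family statements:
(1) `BSD(E_n, 2)` ON THE NAMED MODEL `E_n = ⟨0,0,0,−n²,0⟩` for every square-free `n` with
`r_an(E_n) = 1` — the famous statement; print decides it on the TYZ / Tian / LLT / Monsky sub-families;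
(2) `BSD(W, 2)` for every globally minimal model `W` of `y² = x³ + Ax`, `A ∈ ℤ∖{0}`, `−A ∉ ℤ²`, of
analytic rank one — NO print; (3) the same for the square-free twists of `⟨0,−6,0,1,0⟩`
(`j = 287496`, class `32a`) — NO print; (4) the same for the square-free twists of `cm8 = ⟨0,4,0,2,0⟩` (`j = 8000`,
`K = ℚ(√−2)`) — NO print. Fact-free (transport by ty2 g0's `CongruentNumber.bsdp_iff` /
`analyticRank_eq` on branch (1); the other branches keep `W` itself).
[cite: SilvermanAEC2009, X.5 Prop. 5.4 and Cor. 5.4.1] [cite: Miller2011LMS, Def. 1.1 (arXiv:1010.2431 p. 3)] -/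
theorem wAllCornerFTwoRamified_iff_models :
    WAllCornerFTwoRamified ↔
      (∀ n : ℕ, Squarefree n → (congruentNumberCurve n).analyticRank = 1 →
          BSDp (congruentNumberCurve n) 2) ∧
      (∀ A : ℤ, A ≠ 0 → ¬ IsSquare (-A) →
        ∀ (W : WeierstrassCurve ℚ) [W.IsElliptic] [W.IsGloballyMinimal],
          (∃ C : VariableChange ℚ, C • (⟨0, 0, 0, (A : ℚ), 0⟩ : WeierstrassCurve ℚ) = W) →
          W.analyticRank = 1 → BSDp W 2) ∧
      (∀ d : ℤ, d ≠ 0 → Squarefree d →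
        ∀ (W : WeierstrassCurve ℚ) [W.IsElliptic] [W.IsGloballyMinimal],
          (∃ C : VariableChange ℚ,
            C • (⟨0, -6, 0, 1, 0⟩ : WeierstrassCurve ℚ).quadraticTwist (d : ℚ) = W) →
          W.analyticRank = 1 → BSDp W 2) ∧
      (∀ d : ℤ, d ≠ 0 → Squarefree d →
        ∀ (W : WeierstrassCurve ℚ) [W.IsElliptic] [W.IsGloballyMinimal],
          (∃ C : VariableChange ℚ, C • cm8.quadraticTwist (d : ℚ) = W) →
          W.analyticRank = 1 → BSDp W 2) := by
  constructor
  · intro h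
    refine ⟨?_, ?_, ?_, ?_⟩
    · intro n hn hr
      haveI := isElliptic_congruentNumberCurve hn.ne_zero
      haveI := isGloballyMinimal_congruentNumberCurve hn
      have hW : ∃ C : VariableChange ℚ, C • congruentNumberCurve n = congruentNumberCurve n :=
        ⟨1, one_smul _ _⟩
      exact h (congruentNumberCurve n) (CongruentNumber.hasCM hn.ne_zero hW) hr
        (CongruentNumber.cmRamified_two hn.ne_zero hW)
    · intro A hA _ W _ _ hW hr
      obtain ⟨C, hC⟩ := hW
      have hA' : (A : ℚ) ≠ 0 := by exact_mod_cast hA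
      obtain ⟨hcm, hram⟩ := hasCM_and_cmRamified_two_of_smul_quartic hA' hC
      exact h W hcm hr hram
    · intro d hd _ W _ _ hW hr
      obtain ⟨C, hC⟩ := hW
      have hd' : (d : ℚ) ≠ 0 := by exact_mod_cast hd
      obtain ⟨hcm, hram⟩ := hasCM_and_cmRamified_two_of_j (W := W)
        (Or.inl (by rw [j_eq_of_smul_twist hd' hC, j_cm16]))
      exact h W hcm hr hram
    · intro d hd _ W _ _ hW hr
      obtain ⟨C, hC⟩ := hW
      have hd' : (d : ℚ) ≠ 0 := by exact_mod_cast hd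
      obtain ⟨hcm, hram⟩ := hasCM_and_cmRamified_two_of_j (W := W)
        (Or.inr (by rw [j_eq_of_smul_twist hd' hC, j_cm8]))
      exact h W hcm hr hram
  · rintro ⟨h₁, h₂, h₃, h₄⟩ W _ _ hcm hr hram
    rcases ramifiedAtlas hcm hram with ⟨n, hn, hW⟩ | ⟨A, hA, hsq, hW⟩ | ⟨d, hd, hsqf, hW⟩ |
        ⟨d, hd, hsqf, hW⟩
    · have hr' : (congruentNumberCurve n).analyticRank = 1 := by
        rw [← CongruentNumber.analyticRank_eq hn.ne_zero hW]; exact hr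
      exact (CongruentNumber.bsdp_iff hn hW 2).2 (h₁ n hn hr')
    · exact h₂ A hA hsq W hW hr
    · exact h₃ d hd hsqf W hW hr
    · exact h₄ d hd hsqf W hW hr

/-- **The crux's consequent "`2` inert" ⟺ p4's two inert slices** (good / bad at `2`).
[folklore] -/
theorem inertUnion_iff_inertSlices :
    (∀ (W : WeierstrassCurve ℚ) [W.IsElliptic] [W.IsGloballyMinimal],
        W.HasCM → W.analyticRank = 1 → CMInert W 2 → BSDp W 2) ↔
      (WAllCornerFTwoInertGood ∧ WAllCornerFTwoInertBad) := by
  constructor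
  · intro h
    exact ⟨fun W _ _ hcm hr hin _ => h W hcm hr hin, fun W _ _ hcm hr hin _ => h W hcm hr hin⟩
  · rintro ⟨hG, hB⟩ W _ _ hcm hr hin
    by_cases hg : Good W 2
    · exact hG W hcm hr hin hg
    · exact hB W hcm hr hin hg

/-- **THE INERT CLASS IN MODEL CURRENCY** (consequent of crux `InertTwoRankOneOfFacts`, item
stmt-BirchSwinnertonDyer-20363; p4's slices `WAllCornerFTwoInertGood ∧ WAllCornerFTwoInertBad`). It is
EQUIVALENT to the conjunction of eight explicit family statements, each "`BSD(W, 2)` for every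
globally minimal model `W` of analytic rank one of …": (1) `y² = x³ + B`, `B ∈ ℤ∖{0}` (`j = 0`: the
cube-sum curves `B = −432n²`, the `36a1`-twists `B = c³` — Shu–Zhai's door —, and everything else;
print: Shu–Zhai 2021 Thm. 1.4 on a sub-family only); (2) the square-free twists of `⟨0,6,0,−3,0⟩`
(`j = 54000`; `E(ℚ)[2] ≅ ℤ/2`, Shu–Zhai-shaped, untested in print); (3) of `27a4 = ⟨0,0,1,−30,63⟩`
(`j = −12288000`; `E(ℚ)[2] = 0`, Kriz–Li-shaped); (4)–(8) of `cm11`, `cm19`, `cm43`, `cm67`, `cm163`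
(`E(ℚ)[2] = 0`, Kriz–Li-shaped; nothing in print at `2`). Fact-free.
[cite: SilvermanAEC2009, X.5 Prop. 5.4 and Cor. 5.4.1] [cite: Miller2011LMS, Def. 1.1 (arXiv:1010.2431 p. 3)] -/
theorem wAllCornerFTwoInert_iff_models :
    (WAllCornerFTwoInertGood ∧ WAllCornerFTwoInertBad) ↔
      (∀ B : ℤ, B ≠ 0 →
        ∀ (W : WeierstrassCurve ℚ) [W.IsElliptic] [W.IsGloballyMinimal],
          (∃ C : VariableChange ℚ, C • (⟨0, 0, 0, 0, (B : ℚ)⟩ : WeierstrassCurve ℚ) = W) →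
          W.analyticRank = 1 → BSDp W 2) ∧
      (∀ d : ℤ, d ≠ 0 → Squarefree d →
        ∀ (W : WeierstrassCurve ℚ) [W.IsElliptic] [W.IsGloballyMinimal],
          (∃ C : VariableChange ℚ,
            C • (⟨0, 6, 0, -3, 0⟩ : WeierstrassCurve ℚ).quadraticTwist (d : ℚ) = W) →
          W.analyticRank = 1 → BSDp W 2) ∧
      (∀ d : ℤ, d ≠ 0 → Squarefree d →
        ∀ (W : WeierstrassCurve ℚ) [W.IsElliptic] [W.IsGloballyMinimal],
          (∃ C : VariableChange ℚ,
            C • (⟨0, 0, 1, -30, 63⟩ : WeierstrassCurve ℚ).quadraticTwist (d : ℚ) = W) →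
          W.analyticRank = 1 → BSDp W 2) ∧
      (∀ d : ℤ, d ≠ 0 → Squarefree d →
        ∀ (W : WeierstrassCurve ℚ) [W.IsElliptic] [W.IsGloballyMinimal],
          (∃ C : VariableChange ℚ, C • cm11.quadraticTwist (d : ℚ) = W) →
          W.analyticRank = 1 → BSDp W 2) ∧
      (∀ d : ℤ, d ≠ 0 → Squarefree d →
        ∀ (W : WeierstrassCurve ℚ) [W.IsElliptic] [W.IsGloballyMinimal],
          (∃ C : VariableChange ℚ, C • cm19.quadraticTwist (d : ℚ) = W) →
          W.analyticRank = 1 → BSDp W 2) ∧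
      (∀ d : ℤ, d ≠ 0 → Squarefree d →
        ∀ (W : WeierstrassCurve ℚ) [W.IsElliptic] [W.IsGloballyMinimal],
          (∃ C : VariableChange ℚ, C • cm43.quadraticTwist (d : ℚ) = W) →
          W.analyticRank = 1 → BSDp W 2) ∧
      (∀ d : ℤ, d ≠ 0 → Squarefree d →
        ∀ (W : WeierstrassCurve ℚ) [W.IsElliptic] [W.IsGloballyMinimal],
          (∃ C : VariableChange ℚ, C • cm67.quadraticTwist (d : ℚ) = W) →
          W.analyticRank = 1 → BSDp W 2) ∧
      (∀ d : ℤ, d ≠ 0 → Squarefree d →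
        ∀ (W : WeierstrassCurve ℚ) [W.IsElliptic] [W.IsGloballyMinimal],
          (∃ C : VariableChange ℚ, C • cm163.quadraticTwist (d : ℚ) = W) →
          W.analyticRank = 1 → BSDp W 2) := by
  haveI := isElliptic_curve27a4
  rw [← inertUnion_iff_inertSlices]
  constructor
  · intro h
    -- each family: read `j` off the model, get `HasCM ∧ CMInert W 2`, apply `h`
    have twist : ∀ (E : WeierstrassCurve ℚ) [E.IsElliptic],
        (E.j = 54000 ∨ E.j = -12288000 ∨ E.j = -32768 ∨ E.j = -884736 ∨ E.j = -884736000 ∨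
          E.j = -147197952000 ∨ E.j = -262537412640768000) →
        ∀ d : ℤ, d ≠ 0 → Squarefree d →
          ∀ (W : WeierstrassCurve ℚ) [W.IsElliptic] [W.IsGloballyMinimal],
            (∃ C : VariableChange ℚ, C • E.quadraticTwist (d : ℚ) = W) →
            W.analyticRank = 1 → BSDp W 2 := by
      intro E _ hjE d hd _ W _ _ hW hr
      obtain ⟨C, hC⟩ := hW
      have hd' : (d : ℚ) ≠ 0 := by exact_mod_cast hd
      have hjW : W.j = E.j := j_eq_of_smul_twist hd' hC
      obtain ⟨hcm, hin⟩ := hasCM_and_cmInert_two_of_j (W := W) (by rw [hjW]; exact hjE)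
      exact h W hcm hr hin
    refine ⟨?_, ?_, ?_, ?_, ?_, ?_, ?_, ?_⟩
    · intro B hB W _ _ hW hr
      obtain ⟨C, hC⟩ := hW
      have hB' : (B : ℚ) ≠ 0 := by exact_mod_cast hB
      obtain ⟨hcm, hin⟩ := hasCM_and_cmInert_two_of_smul_sextic hB' hC
      exact h W hcm hr hin
    · exact twist _ (Or.inl j_cm12)
    · exact twist _ (Or.inr (Or.inl j_curve27a4))
    · exact twist _ (Or.inr (Or.inr (Or.inl j_cm11)))
    · exact twist _ (Or.inr (Or.inr (Or.inr (Or.inl j_cm19))))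
    · exact twist _ (Or.inr (Or.inr (Or.inr (Or.inr (Or.inl j_cm43)))))
    · exact twist _ (Or.inr (Or.inr (Or.inr (Or.inr (Or.inr (Or.inl j_cm67))))))
    · exact twist _ (Or.inr (Or.inr (Or.inr (Or.inr (Or.inr (Or.inr j_cm163))))))
  · rintro ⟨h₁, h₂, h₃, h₄, h₅, h₆, h₇, h₈⟩ W _ _ hcm hr hin
    rcases inertAtlas hcm hin with ⟨B, hB, hW⟩ | ⟨d, hd, hsq, hW⟩ | ⟨d, hd, hsq, hW⟩ |
        ⟨d, hd, hsq, hW⟩ | ⟨d, hd, hsq, hW⟩ | ⟨d, hd, hsq, hW⟩ | ⟨d, hd, hsq, hW⟩ | ⟨d, hd, hsq, hW⟩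
    · exact h₁ B hB W hW hr
    · exact h₂ d hd hsq W hW hr
    · exact h₃ d hd hsq W hW hr
    · exact h₄ d hd hsq W hW hr
    · exact h₅ d hd hsq W hW hr
    · exact h₆ d hd hsq W hW hr
    · exact h₇ d hd hsq W hW hr
    · exact h₈ d hd hsq W hW hr

/-- **THE SPLIT-BAD CLASS IN MODEL CURRENCY** (consequent of crux `SplitBadTwoRankOneOfFacts`, item
stmt-BirchSwinnertonDyer-20368 = S1's stmt-19140; p4's slice `WAllCornerFTwoSplitBad`): it is
EQUIVALENT to "`BSD(W, 2)` for every globally minimal model `W`, BAD at `2`, of analytic rank one, of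
a square-free twist of `cm7 = 49a1`" ∧ "the same for `⟨0,−42,0,−7,0⟩` (`j = 16581375`)". On the
`49a1` side "bad at `2`" is `d ≢ 1 (mod 4)` (route GoldfeldAllTwistsTwoConverse,
`exists_squarefree_twist_of_j_neg3375_of_not_good_two`); the second side is `2`-isogenous to the
first (Cassels) — neither refinement is restated here. Fact-free.
[cite: SilvermanAEC2009, X.5 Prop. 5.4 and Cor. 5.4.1] [cite: Miller2011LMS, Def. 1.1 (arXiv:1010.2431 p. 3)] -/
theorem wAllCornerFTwoSplitBad_iff_models :
    WAllCornerFTwoSplitBad ↔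
      (∀ d : ℤ, d ≠ 0 → Squarefree d →
        ∀ (W : WeierstrassCurve ℚ) [W.IsElliptic] [W.IsGloballyMinimal],
          (∃ C : VariableChange ℚ, C • cm7.quadraticTwist (d : ℚ) = W) →
          ¬ Good W 2 → W.analyticRank = 1 → BSDp W 2) ∧
      (∀ d : ℤ, d ≠ 0 → Squarefree d →
        ∀ (W : WeierstrassCurve ℚ) [W.IsElliptic] [W.IsGloballyMinimal],
          (∃ C : VariableChange ℚ,
            C • (⟨0, -42, 0, -7, 0⟩ : WeierstrassCurve ℚ).quadraticTwist (d : ℚ) = W) →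
          ¬ Good W 2 → W.analyticRank = 1 → BSDp W 2) := by
  constructor
  · intro h
    refine ⟨?_, ?_⟩
    · intro d hd _ W _ _ hW hg hr
      obtain ⟨C, hC⟩ := hW
      have hd' : (d : ℚ) ≠ 0 := by exact_mod_cast hd
      obtain ⟨hcm, hsp⟩ := hasCM_and_cmSplit_two_of_j (W := W)
        (Or.inl (by rw [j_eq_of_smul_twist hd' hC, j_cm7]))
      exact h W hcm hr hsp hg
    · intro d hd _ W _ _ hW hg hr
      obtain ⟨C, hC⟩ := hW
      have hd' : (d : ℚ) ≠ 0 := by exact_mod_cast hd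
      obtain ⟨hcm, hsp⟩ := hasCM_and_cmSplit_two_of_j (W := W)
        (Or.inr (by rw [j_eq_of_smul_twist hd' hC, j_cm28]))
      exact h W hcm hr hsp hg
  · rintro ⟨h₁, h₂⟩ W _ _ hcm hr hsp hg
    rcases splitAtlas hsp with ⟨d, hd, hsq, hW⟩ | ⟨d, hd, hsq, hW⟩
    · exact h₁ d hd hsq W hW hg hr
    · exact h₂ d hd hsq W hW hg hr

end Summit.BirchSwinnertonDyer.Rank1Residual.P2.CornerFTwo

end
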